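/-
Copyright (c) 2026 the pub-hodgecm-mathlib formalisation cell (harness21).  Prover seat hodgecm-mathlib-K2E1-p09 (g4), Track B ∕ K2-LIT,
h413 = `stmt-HodgeConjecture-24833`, line `K2_E1_TraceFormulaBeta`, campaign RES-RANK-ONE (toward (H4-b), rank-one Eisenstein theory);
DEAL of the dealer K2E1-plan (g2) 2026-09-04T03:44:10Z ∕ 03:47:30Z («`K2E1BruhatCosetsU`»).
-/
import Literature.NumberTheory.Automorphic.U2LocalBruhatDecomposition   -- ★ Bruhat for `U(σ,Φ₂)(K)`; transitively ★ `U3LocalBruhatDecompositionProofs` (`U(σ,Φ₃)`, `weylLongU`, `borelU`, `unipotentU`)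
import Literature.NumberTheory.Automorphic.LocalUnitaryGroupCongr        -- ★ `antidiagOne_eq_over` (the route's literal `Φ_N`)
import Literature.NumberTheory.Automorphic.AdelicUnitaryGroup            -- ★ `cmConjRingHom`
import HarnessLib

/-!
# h413 ∕ Track B «K2-LIT», campaign RES-RANK-ONE — helper `K2E1BruhatCosetsU`: the COSET FORM of the rank-one Bruhat decomposition of
# `U(Φ₂)(K)` and `U(Φ₃)(K)`: `B(K)\G(K) = {[1]} ⊔ {[w₀ n] : n ∈ N(K)}`, and the corner test `g ∈ B ↔ g_{N−1,0} = 0`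

Cell `pub/hodgecm-mathlib`, crux H413 = `stmt-HodgeConjecture-24833`, route `HCCMUnconditional`; chair K2-lead (g0), dealer K2E1-plan (g2).  THEOREMS ONLY (no
`def`, no `instance`, no `notation`, no named-fact hypothesis, no `sorry`); lane `--kind proof --supports stmt-HodgeConjecture-24833 --as helper` (count-neutral).

The Bruhat decomposition `U(σ, Φ_N)(K) = B_U ⊔ B_U · w₀ · N_U` itself — existence, disjointness, UNIQUE big-cell coordinates `(b, n)`, `w₀ = Φ_N ∈ U` — is ★
Literature for `N = 2` (`U2LocalBruhatDecomposition`: `mem_borelU_or_exists_eq_mul_weylLongU_mul_two`, `mul_weylLongU_mul_not_mem_borelU_two`,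
`eq_of_mul_weylLongU_mul_eq_two`) and `N = 3` (`U3LocalBruhatDecompositionProofs` §3, the same names without `_two`), over ANY field `K` with ANY ring endomorphism
`σ`, `hJ : J = (StdForm.antidiagonal N).over K`, in the currency ★ `unitaryGroupOfForm σ J ⊇ borelU ∕ unipotentU`, ★ `weylLongU σ hJ`.  This file adds what the two
consumers of the campaign need — the constant term of the Borel Eisenstein series `E_B = φ_s + M(s)φ_s` (K2Liu junction: ★ `K2Lit.SiegelUnitary.eisensteinSeries`, a
`tsum` over the coset type `Quotient (MulAction.orbitRel ↥P ↥G)`, `P = siegelOf = {g₂₁ = 0}` at `m = 1`) and the unfolding of `CT(θ_Φ)` over `Γ ⧸ (Γ ∩ N)`: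
* §1 PURE GROUP THEORY (any group `G`, subgroups `B`, `N`, element `w`): from the trichotomy (existence, disjointness, uniqueness) the coset space of the LEFT
  multiplication action of `B` is `{[1]} ⊔ {[w n] : n ∈ N}` with `n ↦ [w n]` injective — `exists_equiv_option_quotient_orbitRel` (`∃ e : Option ↥N ≃ B\G`,
  `e none = [1]`, `e (some n) = [w n]`; reindex sums by `Equiv.tsum_eq`), `mk_eq_mk_one_iff` (`[g] = [1] ↔ g ∈ B`), `exists_out_mk_mul_eq` (`[w n].out = b w n`);
* §2 `N = 2` and §3 `N = 3`: the instances **`exists_equiv_option_borelQuotient_two ∕ _three`**, **`mk_eq_mk_one_iff_mem_borelU`**, and the CORNER TEST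
  **`mem_borelU_iff_apply_eq_zero_two`** (`g ∈ B_U ↔ g₁₀ = 0`) ∕ **`mem_borelU_iff_apply_eq_zero_three`** (`g ∈ B_U ↔ g₂₀ = 0`; `⇐` by Bruhat: `(b w₀ n)₂₀ = b₂₂ ≠ 0`) —
  the one-line bridge to K2Liu's `siegelOf` (`g₂₁ = 0`);
* §4 the CM reading: `K = L` a CM field, `σ = cmConjRingHom L`, `J = Φ_N` the route's literal matrix (★ `antidiagOne_eq_over`).

HONEST LABEL.  Count-neutral helper; proves no printed statement; HC_CM is proved only modulo the 7 printed citations (2 remaining named inputs: hLiu418 =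
`stmt-HodgeConjecture-24832`, h413 = `stmt-HodgeConjecture-24833`) until rung 0 closes.

## References
* [Rogawski1990] J. D. Rogawski, *Automorphic Representations of Unitary Groups in Three Variables* (1990), §1.10 p. 9, §2.1.
* [Casselman1995] W. Casselman, *Introduction to the theory of admissible representations of p-adic reductive groups* (1995), Prop. 1.3.1, Prop. 1.3.3.
* [BorelTits1965] A. Borel, J. Tits, *Groupes réductifs*, Publ. Math. IHÉS 27 (1965), §5 Thm. 5.15.
* [MoeglinWaldspurger1995] C. Mœglin, J.-L. Waldspurger, *Spectral decomposition and Eisenstein series* (1995), II.1.7 (constant terms of Eisenstein series).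
-/

set_option autoImplicit false
set_option linter.dupNamespace false  -- the mandated namespace repeats the summit's segment (`HodgeConjecture.HodgeConjecture`)

open Matrix MulAction
open Literature.NumberTheory.Automorphic Literature.NumberTheory.Automorphic.UnitaryGroup

namespace Summit.HodgeConjecture.HodgeConjecture.Cruxes.H413.K2E1BruhatCosetsU

/-! ## §1 Pure group theory: a rank-one Bruhat trichotomy makes `B\G` the set `{[1]} ⊔ {[w n] : n ∈ N}` -/

section Abstract

variable {G : Type*} [Group G] {B : Subgroup G}

/-- Two elements have the same class in `B\G` (orbits of the LEFT multiplication action of `B`) iff they differ by a left factor in `B`. [folklore] -/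
theorem mk_eq_mk_iff (a b : G) : Quotient.mk (orbitRel B G) a = Quotient.mk (orbitRel B G) b ↔ ∃ x : B, (x : G) * b = a :=
  ⟨fun h => mem_orbit_iff.1 (Quotient.exact h), fun h => Quotient.sound (mem_orbit_iff.2 h)⟩

/-- `[g] = [1]` in `B\G` iff `g ∈ B`. [folklore] -/
theorem mk_eq_mk_one_iff (g : G) : Quotient.mk (orbitRel B G) g = Quotient.mk (orbitRel B G) 1 ↔ g ∈ B := by
  rw [mk_eq_mk_iff]
  constructor
  · rintro ⟨x, hx⟩
    rw [mul_one] at hx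
    exact hx ▸ x.2
  · intro hg
    exact ⟨⟨g, hg⟩, mul_one g⟩

/-- The chosen representative of the class of `g` is `b g` for some `b ∈ B`. [folklore] -/
theorem exists_out_mk_eq (g : G) : ∃ b ∈ B, (Quotient.mk (orbitRel B G) g).out = b * g := by
  obtain ⟨x, hx⟩ := (mk_eq_mk_iff _ _).1 (Quotient.out_eq (Quotient.mk (orbitRel B G) g))
  exact ⟨x, x.2, hx.symm⟩

variable {N : Subgroup G} {w : G}

/-- **THE COSET FORM OF A RANK-ONE BRUHAT DECOMPOSITION** (pure group theory).  If every `g ∈ G` lies in `B` or is `b w n` (`b ∈ B`, `n ∈ N`), no `b w n` lies in `B`,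
and the coordinates `(b, n)` of `b w n` are unique, then `B\G = {[1]} ⊔ {[w n] : n ∈ N}` with `n ↦ [w n]` injective: there is an equivalence
`e : Option ↥N ≃ B\G` with `e none = [1]` and `e (some n) = [w n]`. [cite: Casselman1995, Prop. 1.3.1, Prop. 1.3.3] [cite: BorelTits1965, §5 Thm. 5.15] -/
theorem exists_equiv_option_quotient_orbitRel (hex : ∀ g : G, g ∈ B ∨ ∃ b ∈ B, ∃ n ∈ N, g = b * w * n)
    (hdisj : ∀ ⦃b n : G⦄, b ∈ B → n ∈ N → b * w * n ∉ B)
    (huniq : ∀ ⦃b b' n n' : G⦄, b ∈ B → b' ∈ B → n ∈ N → n' ∈ N → b * w * n = b' * w * n' → b = b' ∧ n = n') :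
    ∃ e : Option ↥N ≃ Quotient (orbitRel B G),
      e none = Quotient.mk (orbitRel B G) 1 ∧ ∀ n : N, e (some n) = Quotient.mk (orbitRel B G) (w * (n : G)) := by
  let f : Option ↥N → Quotient (orbitRel B G) := fun o => o.elim (Quotient.mk (orbitRel B G) 1) fun n => Quotient.mk (orbitRel B G) (w * (n : G))
  -- `[w n] ≠ [1]`
  have hne : ∀ n : N, Quotient.mk (orbitRel B G) (w * (n : G)) ≠ Quotient.mk (orbitRel B G) 1 := fun n h =>
    hdisj B.one_mem n.2 (by rw [one_mul]; exact (mk_eq_mk_one_iff _).1 h)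
  -- `[w n] = [w n'] → n = n'`
  have hinjN : ∀ n n' : N, Quotient.mk (orbitRel B G) (w * (n : G)) = Quotient.mk (orbitRel B G) (w * (n' : G)) → n = n' := by
    intro n n' h
    obtain ⟨x, hx⟩ := (mk_eq_mk_iff _ _).1 h
    have h1 : (x : G) * w * n' = 1 * w * n := by rw [one_mul, mul_assoc, hx]
    exact Subtype.ext ((huniq x.2 B.one_mem n'.2 n.2 h1).2).symm
  have hinj : Function.Injective f := by
    rintro (_ | n) (_ | n') h
    · rfl
    · exact absurd h.symm (hne n')
    · exact absurd h (hne n)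
    · rw [hinjN n n' h]
  have hsurj : Function.Surjective f := by
    intro q
    induction q using Quotient.inductionOn with
    | h g =>
      rcases hex g with hg | ⟨b, hb, n, hn, rfl⟩
      · exact ⟨none, ((mk_eq_mk_one_iff g).2 hg).symm⟩
      · exact ⟨some ⟨n, hn⟩, ((mk_eq_mk_iff _ _).2 ⟨⟨b, hb⟩, (mul_assoc b w n).symm⟩).symm⟩
  exact ⟨Equiv.ofBijective f ⟨hinj, hsurj⟩, rfl, fun n => rfl⟩

/-- Representatives: `[w n].out = b · w · n` for some `b ∈ B` (so a LEFT-`B`-invariant summand evaluated at `Quotient.out` reads `f(w n)`). [folklore] -/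
theorem exists_out_mk_mul_eq (n : G) : ∃ b ∈ B, (Quotient.mk (orbitRel B G) (w * n)).out = b * w * n := by
  obtain ⟨b, hb, h⟩ := exists_out_mk_eq (B := B) (w * n)
  exact ⟨b, hb, by rw [h, mul_assoc]⟩

end Abstract

/-! ## §2 `U(σ, Φ₂)(K) ≅ U(1,1)`: coset form and corner test -/

section Two

variable {K : Type*} [Field K] (σ : K →+* K) {J : Matrix (Fin 2) (Fin 2) K} (hJ : J = (StdForm.antidiagonal 2).over K)
include hJ

/-- **`B(K)\U(Φ₂)(K) = {[1]} ⊔ {[w₀ n] : n ∈ N(K)}`**: an equivalence `Option ↥N_U ≃ B_U\U` sending `none ↦ [1]`, `some n ↦ [w₀ n]` (§1 at the ★ Bruhat trichotomy of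
`U2LocalBruhatDecomposition`). [cite: Casselman1995, Prop. 1.3.1, Prop. 1.3.3] [cite: Rogawski1990, §1.10 p. 9] -/
theorem exists_equiv_option_borelQuotient_two :
    ∃ e : Option ↥(unipotentU σ J) ≃ Quotient (orbitRel ↥(borelU σ J) ↥(unitaryGroupOfForm σ J)),
      e none = Quotient.mk _ 1 ∧ ∀ n : unipotentU σ J, e (some n) = Quotient.mk _ (weylLongU σ hJ * (n : ↥(unitaryGroupOfForm σ J))) :=
  exists_equiv_option_quotient_orbitRel (mem_borelU_or_exists_eq_mul_weylLongU_mul_two σ hJ)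
    (fun _ _ hb hn => mul_weylLongU_mul_not_mem_borelU_two σ hJ hb hn) (fun _ _ _ _ hb hb' hn hn' h => eq_of_mul_weylLongU_mul_eq_two σ hJ hb hb' hn hn' h)

omit hJ in
/-- **CORNER TEST, `N = 2`**: `g ∈ B_U ↔ g₁₀ = 0` (the only sub-diagonal entry of a `2 × 2` matrix). [cite: Rogawski1990, §1.10 p. 9] -/
theorem mem_borelU_iff_apply_eq_zero_two (g : ↥(unitaryGroupOfForm σ J)) :
    g ∈ borelU σ J ↔ ((g : GL (Fin 2) K) : Matrix (Fin 2) (Fin 2) K) 1 0 = 0 := by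
  rw [mem_borelU_iff]
  refine ⟨fun h => h (by decide), fun h i j hij => ?_⟩
  fin_cases i <;> fin_cases j <;> simp_all

/-- In the big cell the corner entry is `b₁₁`: `(b · w₀ · n)₁₀ = b₁₁` for `b ∈ B_U`, `n ∈ N_U`. [cite: Rogawski1990, §1.10 p. 9] -/
theorem apply_mul_weylLongU_mul_two {b n : ↥(unitaryGroupOfForm σ J)} (hb : b ∈ borelU σ J) (hn : n ∈ unipotentU σ J) :
    (((b * weylLongU σ hJ * n : ↥(unitaryGroupOfForm σ J)) : GL (Fin 2) K) : Matrix (Fin 2) (Fin 2) K) 1 0 =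
      ((b : GL (Fin 2) K) : Matrix (Fin 2) (Fin 2) K) 1 1 := by
  have hb10 : ((b : GL (Fin 2) K) : Matrix (Fin 2) (Fin 2) K) 1 0 = 0 := (mem_borelU_iff_apply_eq_zero_two σ b).1 hb
  obtain ⟨hnT, hnd⟩ := (mem_unipotentU_iff n).1 hn
  have hn10 : ((n : GL (Fin 2) K) : Matrix (Fin 2) (Fin 2) K) 1 0 = 0 := hnT (by decide)
  have hw : (((weylLongU σ hJ : ↥(unitaryGroupOfForm σ J)) : GL (Fin 2) K) : Matrix (Fin 2) (Fin 2) K) = (StdForm.antidiagonal 2).over K := by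
    rw [coe_coe_weylLongU, hJ]
  rw [Subgroup.coe_mul, Subgroup.coe_mul, Units.val_mul, Units.val_mul, hw]
  simp only [Matrix.mul_apply, Fin.sum_univ_two, StdForm.over, Matrix.map_apply, StdForm.antidiagonal_J_apply]
  simp [hb10, hn10, hnd 0, Fin.rev]

end Two

/-! ## §3 `U(σ, Φ₃)(K)`: coset form and corner test -/

section Three

variable {K : Type*} [Field K] (σ : K →+* K) {J : Matrix (Fin 3) (Fin 3) K} (hJ : J = (StdForm.antidiagonal 3).over K)
include hJ

/-- **`B(K)\U(Φ₃)(K) = {[1]} ⊔ {[w₀ n] : n ∈ N(K)}`** (`N` the Heisenberg group): an equivalence `Option ↥N_U ≃ B_U\U`, `none ↦ [1]`, `some n ↦ [w₀ n]` (§1 at the ★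
Bruhat trichotomy of `U3LocalBruhatDecompositionProofs`). [cite: Rogawski1990, §1.10 p. 9] [cite: Casselman1995, Prop. 1.3.1, Prop. 1.3.3] -/
theorem exists_equiv_option_borelQuotient_three :
    ∃ e : Option ↥(unipotentU σ J) ≃ Quotient (orbitRel ↥(borelU σ J) ↥(unitaryGroupOfForm σ J)),
      e none = Quotient.mk _ 1 ∧ ∀ n : unipotentU σ J, e (some n) = Quotient.mk _ (weylLongU σ hJ * (n : ↥(unitaryGroupOfForm σ J))) :=
  exists_equiv_option_quotient_orbitRel (mem_borelU_or_exists_eq_mul_weylLongU_mul σ hJ)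
    (fun _ _ hb hn => mul_weylLongU_mul_not_mem_borelU σ hJ hb hn) (fun _ _ _ _ hb hb' hn hn' h => eq_of_mul_weylLongU_mul_eq σ hJ hb hb' hn hn' h)

/-- In the big cell the corner entry is `b₂₂`: `(b · w₀ · n)₂₀ = b₂₂` for `b ∈ B_U`, `n ∈ N_U`. [cite: Rogawski1990, §1.10 p. 9] -/
theorem apply_mul_weylLongU_mul_three {b n : ↥(unitaryGroupOfForm σ J)} (hb : b ∈ borelU σ J) (hn : n ∈ unipotentU σ J) :
    (((b * weylLongU σ hJ * n : ↥(unitaryGroupOfForm σ J)) : GL (Fin 3) K) : Matrix (Fin 3) (Fin 3) K) 2 0 =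
      ((b : GL (Fin 3) K) : Matrix (Fin 3) (Fin 3) K) 2 2 := by
  have hbT := (mem_borelU_iff b).1 hb
  have hb20 : ((b : GL (Fin 3) K) : Matrix (Fin 3) (Fin 3) K) 2 0 = 0 := hbT (by decide)
  have hb21 : ((b : GL (Fin 3) K) : Matrix (Fin 3) (Fin 3) K) 2 1 = 0 := hbT (by decide)
  obtain ⟨hnT, hnd⟩ := (mem_unipotentU_iff n).1 hn
  have hn10 : ((n : GL (Fin 3) K) : Matrix (Fin 3) (Fin 3) K) 1 0 = 0 := hnT (by decide)
  have hn20 : ((n : GL (Fin 3) K) : Matrix (Fin 3) (Fin 3) K) 2 0 = 0 := hnT (by decide)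
  have hw : (((weylLongU σ hJ : ↥(unitaryGroupOfForm σ J)) : GL (Fin 3) K) : Matrix (Fin 3) (Fin 3) K) = (StdForm.antidiagonal 3).over K := by
    rw [coe_coe_weylLongU, hJ]
  rw [Subgroup.coe_mul, Subgroup.coe_mul, Units.val_mul, Units.val_mul, hw]
  simp only [Matrix.mul_apply, Fin.sum_univ_three, StdForm.over, Matrix.map_apply, StdForm.antidiagonal_J_apply]
  simp [hb20, hb21, hn10, hn20, hnd 0, Fin.rev]

omit hJ in
/-- Diagonal entries of an element of `B_U` are non-zero (`det b = ∏ bᵢᵢ`, Mathlib `Matrix.det_of_upperTriangular`). [folklore] -/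
theorem apply_diag_ne_zero_of_mem_borelU {N : ℕ} {J' : Matrix (Fin N) (Fin N) K} {b : ↥(unitaryGroupOfForm σ J')} (hb : b ∈ borelU σ J') (i : Fin N) :
    ((b : GL (Fin N) K) : Matrix (Fin N) (Fin N) K) i i ≠ 0 := by
  intro h0
  have hdet : ((b : GL (Fin N) K) : Matrix (Fin N) (Fin N) K).det = 0 := by
    rw [Matrix.det_of_upperTriangular ((mem_borelU_iff b).1 hb)]
    exact Finset.prod_eq_zero (Finset.mem_univ i) h0
  exact (Matrix.isUnit_iff_isUnit_det _ |>.1 (b : GL (Fin N) K).isUnit).ne_zero hdet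

/-- **CORNER TEST, `N = 3`**: `g ∈ B_U ↔ g₂₀ = 0` — `⇒` is upper-triangularity; `⇐` is the Bruhat decomposition: off `B_U`, `g = b w₀ n` has `g₂₀ = b₂₂ ≠ 0`.  (So for
UNITARY `g` the single corner entry decides membership in the Borel: the bridge to «`g₂₁ = 0`» parabolics such as K2Liu's `siegelOf`.) [cite: Rogawski1990, §1.10 p. 9] -/
theorem mem_borelU_iff_apply_eq_zero_three (g : ↥(unitaryGroupOfForm σ J)) :
    g ∈ borelU σ J ↔ ((g : GL (Fin 3) K) : Matrix (Fin 3) (Fin 3) K) 2 0 = 0 := by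
  refine ⟨fun h => (mem_borelU_iff g).1 h (by decide), fun h => ?_⟩
  rcases mem_borelU_or_exists_eq_mul_weylLongU_mul σ hJ g with hg | ⟨b, hb, n, hn, rfl⟩
  · exact hg
  · exact absurd (by rwa [apply_mul_weylLongU_mul_three σ hJ hb hn] at h) (apply_diag_ne_zero_of_mem_borelU σ hb 2)

end Three

/-! ## §4 The CM reading: `K = L` a CM field, `σ =` complex conjugation, `J = Φ_N` the route's literal matrix -/

section CM

open NumberField

variable (L : Type) [Field L] [NumberField L] [IsCMField L]

/-- **`B(L⁺)\U(Φ₂)(L⁺) = {[1]} ⊔ {[Φ₂ · n] : n ∈ N(L⁺)}`** for the route's `U(Φ₂)(L⁺) = unitaryGroupOfForm (cmConjRingHom L) Φ₂ ≤ GL₂(L)` (the subgroup of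
`(cmDatum L 2 Φ₂).Rational`, ★ `unitaryGroup_eq_unitaryGroupOfForm`; K2Liu's `rational L⁺ L c 2 J` spells `σ` as `(c : L →+* L)` — §2 applies to that spelling verbatim),
`Φ₂` literal (★ `antidiagOne_eq_over`). [cite: Rogawski1990, §1.10 p. 9] -/
theorem exists_equiv_option_borelQuotient_cm_two :
    ∃ e : Option ↥(unipotentU (cmConjRingHom L) (Matrix.of fun i j : Fin 2 => if i.val + j.val + 1 = 2 then (1 : L) else 0)) ≃
        Quotient (orbitRel ↥(borelU (cmConjRingHom L) (Matrix.of fun i j : Fin 2 => if i.val + j.val + 1 = 2 then (1 : L) else 0))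
          ↥(unitaryGroupOfForm (cmConjRingHom L) (Matrix.of fun i j : Fin 2 => if i.val + j.val + 1 = 2 then (1 : L) else 0))),
      e none = Quotient.mk _ 1 ∧ ∀ n, e (some n) = Quotient.mk _ (weylLongU (cmConjRingHom L) (antidiagOne_eq_over (L := L) (N := 2)) *
        (n : ↥(unitaryGroupOfForm (cmConjRingHom L) (Matrix.of fun i j : Fin 2 => if i.val + j.val + 1 = 2 then (1 : L) else 0)))) :=
  exists_equiv_option_borelQuotient_two (cmConjRingHom L) (antidiagOne_eq_over (L := L) (N := 2))

/-- **`B(L⁺)\U(Φ₃)(L⁺) = {[1]} ⊔ {[Φ₃ · n] : n ∈ N(L⁺)}`** for the route's `U(Φ₃)(L⁺) = unitaryGroupOfForm (cmConjRingHom L) Φ₃ ≤ GL₃(L)`, `Φ₃` literal.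
[cite: Rogawski1990, §1.10 p. 9] -/
theorem exists_equiv_option_borelQuotient_cm_three :
    ∃ e : Option ↥(unipotentU (cmConjRingHom L) (Matrix.of fun i j : Fin 3 => if i.val + j.val + 1 = 3 then (1 : L) else 0)) ≃
        Quotient (orbitRel ↥(borelU (cmConjRingHom L) (Matrix.of fun i j : Fin 3 => if i.val + j.val + 1 = 3 then (1 : L) else 0))
          ↥(unitaryGroupOfForm (cmConjRingHom L) (Matrix.of fun i j : Fin 3 => if i.val + j.val + 1 = 3 then (1 : L) else 0))),
      e none = Quotient.mk _ 1 ∧ ∀ n, e (some n) = Quotient.mk _ (weylLongU (cmConjRingHom L) (antidiagOne_eq_over (L := L) (N := 3)) *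
        (n : ↥(unitaryGroupOfForm (cmConjRingHom L) (Matrix.of fun i j : Fin 3 => if i.val + j.val + 1 = 3 then (1 : L) else 0)))) :=
  exists_equiv_option_borelQuotient_three (cmConjRingHom L) (antidiagOne_eq_over (L := L) (N := 3))

/-- The corner tests for the route's literal `Φ₂`, `Φ₃` over the CM field `L`: `g ∈ B ↔ g₁₀ = 0`, resp. `g ∈ B ↔ g₂₀ = 0`. [cite: Rogawski1990, §1.10 p. 9] -/
theorem mem_borelU_iff_apply_eq_zero_cm :
    (∀ g : ↥(unitaryGroupOfForm (cmConjRingHom L) (Matrix.of fun i j : Fin 2 => if i.val + j.val + 1 = 2 then (1 : L) else 0)),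
        g ∈ borelU (cmConjRingHom L) _ ↔ ((g : GL (Fin 2) L) : Matrix (Fin 2) (Fin 2) L) 1 0 = 0) ∧
      ∀ g : ↥(unitaryGroupOfForm (cmConjRingHom L) (Matrix.of fun i j : Fin 3 => if i.val + j.val + 1 = 3 then (1 : L) else 0)),
        g ∈ borelU (cmConjRingHom L) _ ↔ ((g : GL (Fin 3) L) : Matrix (Fin 3) (Fin 3) L) 2 0 = 0 :=
  ⟨fun g => mem_borelU_iff_apply_eq_zero_two (cmConjRingHom L) g,
    fun g => mem_borelU_iff_apply_eq_zero_three (cmConjRingHom L) (antidiagOne_eq_over (L := L) (N := 3)) g⟩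

end CM

end Summit.HodgeConjecture.HodgeConjecture.Cruxes.H413.K2E1BruhatCosetsU
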